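import Summits.NavierStokesRegularity.NavierStokesRegularity.Theorems.SoloRefuteZeroual2026Uniqueness
import HarnessLib

/-!
# C157 `Zeroual2026` — the cited energy inequality `Step_Energy` is false AS TYPED (custodian kit, typist-4 g7; records-grade)

`Literature.Claims.NS.Zeroual2026.Step_Energy` (skeleton l.341) types the energy inequality the text cites as
Thm 1.2 (Leray) p.4 l.37–42, `∫|u(t)|² ≤ ∫|u₀|²` for `t ≥ 0`, along EVERY solution of the printed class
`IsSolutionOn ν (Ici 0) u₀ u p` (Def 1.1 p.4 l.21–35: (1.1)–(1.3) classically on `ℝ³ × [0,∞)`, jointly smooth,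
`u(0) = u₀`; NO decay or energy class on the solution) from a datum of the class `IsDatum` (`C^∞`,
divergence-free, `H¹`). At that width the statement is false in the kernel, by the witness already used for the
row's uniqueness face (`…Theorems.Zeroual2026Uniqueness.not_claimedUniqueness`, p545031) and for the C143 /
C163 energy faces (`…Theorems.Guevremont2026Energy.not_step1_EnergyEq`, `…SoloRefuteSeo2025Energy`): the
uniformly accelerating stream `u(t,x) = t·e₀`, `p(t,x) = −x₀` (`RomanMiller2011.stream id` /
`streamPressure id`) is a solution of the class from the ZERO datum for every `ν`
(`Zeroual2026Uniqueness.isSolutionOn_stream`, reused — not re-declared), and at `t = 1` its energy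
`∫|u(1)|² = ∫ 1 = ∞` exceeds `∫|u₀|² = 0`. Hence `¬ Step_Energy`.

Records-grade only: since rev 4 (`clayA_of_claimed`, CLAY-LINK keeper lit-4 g8) the Clay link of C157 is
binder-free, so `Step_Energy` is consumed by nothing on the composition path (`claim_of_steps` does not take
it; only the superseded `clay_of_claimed` / `clay_of_claimed'` do, vacuously); the head of #140
(`Step1_Thm41`, `…Theorems.Zeroual2026.not_Step1_Thm41`), its class FL and every total are untouched; nothing
is re-keyed. DEBT effect: `Zeroual2026.Step_Energy` OPEN → REFUTED.

WHAT THIS IS NOT: not a claim about NS regularity or blow-up; not a claim about any author beyond the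
typed locator.
-/

set_option linter.dupNamespace false

noncomputable section

open Set Function MeasureTheory
open scoped ContDiff ENNReal
open Literature.Analysis.FluidPDE
open Literature.Claims.NS.Zeroual2026 (E3 IsDatum IsSolutionOn)
open Summit.NavierStokesRegularity.NavierStokesRegularity.Theorems.RomanMiller2011
  (e0 stream streamPressure)
open Summit.NavierStokesRegularity.NavierStokesRegularity.Theorems.Zeroual2026Uniqueness
  (isSolutionOn_stream)

namespace Summit.NavierStokesRegularity.NavierStokesRegularity.Theorems.Zeroual2026Energy

/-- **`Step_Energy` as typed is false.** Witness: `ν = 1`, the zero datum, the accelerating stream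
`stream id` with pressure `streamPressure id`, `t = 1`: `∫⁻ ‖u 1‖ₑ² = ⊤` while `∫⁻ ‖u₀‖ₑ² = 0`.
[cite: Zeroual2026, Thm 1.2 p.4 l.37–42; Def 1.1 p.4 l.21–35] -/
theorem not_Step_Energy : ¬ Literature.Claims.NS.Zeroual2026.Step_Energy := by
  intro h
  -- the zero field is a datum of the printed class (`C^∞`, divergence-free, `∫|0|² = ∫|D0|² = 0 < ∞`);
  -- inlined (as in the sibling uniqueness kit) so that no standalone `IsDatum 0` lemma is re-declared
  have hD0 : IsDatum (0 : E3 → E3) := by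
    refine ⟨contDiff_const, fun x => ?_, ?_, ?_⟩
    · simp [VectorCalculus.divergence]
    · have h0 : (fun x : E3 => ‖(0 : E3 → E3) x‖ₑ ^ 2) = fun _ => 0 := by
        funext x
        simp
      show (∫⁻ x, ‖(0 : E3 → E3) x‖ₑ ^ 2) < ⊤
      rw [h0, lintegral_zero]
      exact ENNReal.zero_lt_top
    · have h0 : (fun x : E3 => ‖fderiv ℝ (0 : E3 → E3) x‖ₑ ^ 2) = fun _ => 0 := by
        funext x
        have hx : fderiv ℝ (0 : E3 → E3) x = 0 := by
          rw [show (0 : E3 → E3) = fun _ => (0 : E3) from rfl, fderiv_const_apply]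
        rw [hx, ← ofReal_norm, norm_zero, ENNReal.ofReal_zero, zero_pow two_ne_zero]
      show (∫⁻ x, ‖fderiv ℝ (0 : E3 → E3) x‖ₑ ^ 2) < ⊤
      rw [h0, lintegral_zero]
      exact ENNReal.zero_lt_top
  -- the typed inequality at `ν = 1`, `t = 1` along the accelerating stream from the zero datum
  have h1 := h 1 one_pos 0 (stream id) (streamPressure id) hD0 (isSolutionOn_stream 1 contDiff_id rfl)
    1 zero_le_one
  -- right-hand side: `∫⁻ ‖0‖ₑ² = 0`
  have hR : (∫⁻ x, ‖(0 : E3 → E3) x‖ₑ ^ 2) = 0 := by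
    have h0 : (fun x : E3 => ‖(0 : E3 → E3) x‖ₑ ^ 2) = fun _ => 0 := by
      funext x
      simp
    rw [h0, lintegral_zero]
  -- left-hand side: at time `1` the stream is the constant unit field `e₀`, so `∫⁻ 1 = ⊤` on `ℝ³`
  have hpt : ∀ x : E3, ‖stream id 1 x‖ₑ ^ 2 = 1 := by
    intro x
    have hn : ‖stream id 1 x‖ = 1 := by
      simp [stream, e0]
    rw [← ofReal_norm, hn]
    simp
  have hL : (∫⁻ x, ‖stream id 1 x‖ₑ ^ 2) = ⊤ := by
    have hvol : (volume : Measure E3) univ = ⊤ := by simp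
    simp_rw [hpt]
    rw [lintegral_const, hvol]
    simp
  rw [hL, hR] at h1
  exact absurd h1 (by simp)

/-- FQN guard: the refuted statement is literally the skeleton's. -/
example : ¬ Literature.Claims.NS.Zeroual2026.Step_Energy := not_Step_Energy

end Summit.NavierStokesRegularity.NavierStokesRegularity.Theorems.Zeroual2026Energy

end

-- WHAT THIS IS NOT: not a claim about NS regularity or blow-up; not a claim about any author beyond the typed locator.
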